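import Literature.MathematicalPhysics.QuantumFieldTheory.Balaban1983to89.B1Eq338Rescaling
import Literature.MathematicalPhysics.QuantumFieldTheory.Balaban1983to89.B1Eq38Rescale

/-!
# `Balaban1983to89.B1Eq338Bridge` — T. Bałaban, *(Higgs)₂,₃ quantum fields in a finite volume. I. A lower bound*,
Commun. Math. Phys. **85** (1982) 603–626 [Balaban1982Higgs1], (3.38) p. 619 with (3.27)–(3.29) p. 617: the BRIDGE
between the (3.38) rescaling theorem of record (`B1Eq338Rescaling.doubleRTk_rescale`, lit-balaban p14, whose
background field on the rescaled lattice is the CONJUGATED assignment `extRescale` and whose restriction `χ(σA′, σφ′)`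
is left abstract) and the (Higgs)₂,₃ model's own objects on the rescaled lattice: **the conjugated background
assignment IS the background field `A^{(k)}` of the rescaled lattice** (`extRescale_bgVec`, from
`HiggsBackgroundRescale.bgVec_rescale`) and **the pulled-back restrictions ARE the characteristic functions
(3.27)–(3.28) of the rescaled lattice** (`B1Eq38Rescale.chiKA_rescale`/`chiKφ_rescale`), whence p14's (3.38) bracket
for the model with every model object identified (`doubleRTk_rescale_model`), PROVED

statement-level skeleton of published theorems with citation tags; proofs where landed; nothing here is a claim about the Yang–Mills mass gap

PDF held: `paper:balaban1982-cmp85-higgs23-i` (journal page = PDF page + 602); pp. 617–619 read from the ×2 renders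
`run/shared/lean/pub/pub-balaban/b2b-balaban-ref1/pages/1982-cmp85-higgs23-I/…-p015/p016/p017-x2.png`.

CITATION HEADER (lean-in-tree rule).  lit-balaban typed skeleton (HOME `run/shared/lean/pub/lit-balaban/`): row
**B1.Eq3.37-3.38** (owner r12; the (3.38) member's theorems of record are p14's `B1Eq338Rescaling` p248048 /
`B1Eq338Display` p248265); this file is a typer-line KNITTING file (no row of its own).  WHAT IS REPRODUCED.  p. 619,
(3.38): the rescaled bracket carries `A^{(k)}` — *the* background field of the unit lattice (p. 617 (3.29) written on
`T^{(k)}_1`) — and the unit-lattice restrictions `χ_k(A)χ_k(φ)`; p. 618: *"a rescaling of all the fields and the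
propagators from L^kε-lattice … to 1-lattice"*.  In `B1Eq338Rescaling` the background after rescaling is
`extRescale hs ext := σ⁻¹·ext(σ·)` and the restriction is `χ(σA′, σφ′)`; here, for `ext = A^{(k),ε}` (3.29)
(`B1Eq31Concrete.bgVec μ₀² a k`) and `χ = χ_k(A)χ_k(A, φ)` (`chiKA·chiKφ` at scale `ℓ`): `extRescale hs A^{(k),ε} =
A^{(k),sε}` with the vector mass `μ₀²s⁻²` (`extRescale_bgVec`), and `χ^{ℓ}(σA′, σφ′) = χ^{sℓ}(A′, φ′)` with masses
`μ₀²s⁻²`, `m²s⁻²` and charge `e_s`; so (`doubleRTk_rescale_model`) `T^{L^kε}_{a,L}[T^{L^kε}_{a,L,A^{(k),ε}}[χ_kχ_k e^{−S}]](σB′, σψ′)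
= rescaleConstK · ∫dA′∫dφ′ χ^{sℓ}_k(A′)χ^{sℓ}_k(A′,φ′)·exp(stepExponent^{sε}_{e_s, A^{(k),sε}}(B′,ψ′;A′,φ′))` — p14's
theorem with the model's background and restrictions on the right.  NOT HERE: the (3.30) form of `S` (p14's
`B1Eq338Display.eq338` takes it as the hypothesis `hS`; unchanged).
Unit `lit-balaban-typer` gen 3 (literature-prover-lit-balaban-typer-g3-0); HOME/FILED.md records the proposal.
-/

open scoped BigOperators
open _root_.MeasureTheory

namespace Literature.MathematicalPhysics.QuantumFieldTheory.Balaban1983to89.B1Eq338Bridge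

open Literature.MathematicalPhysics.QuantumFieldTheory.Balaban1983to89.HiggsLattice
open Literature.MathematicalPhysics.QuantumFieldTheory.Balaban1983to89.HiggsAveraging
open Literature.MathematicalPhysics.QuantumFieldTheory.Balaban1983to89.HiggsRescaling
open Literature.MathematicalPhysics.QuantumFieldTheory.Balaban1983to89.HiggsDoubleRT
open Literature.MathematicalPhysics.QuantumFieldTheory.Balaban1983to89.HiggsBackgroundRescale (bgVec_rescale)
open Literature.MathematicalPhysics.QuantumFieldTheory.Balaban1983to89.B1Eq338Rescaling
  (extRescale stepExponent rescaleConstK)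
open Literature.MathematicalPhysics.QuantumFieldTheory.Balaban1983to89.B1Eq31Concrete
open Literature.MathematicalPhysics.QuantumFieldTheory.Balaban1983to89.B1Eq38Rescale (chiKA_rescale chiKφ_rescale)
open Literature.MathematicalPhysics.QuantumFieldTheory.Balaban1983to89.B1Ineq337HiggsModel (cutoffDensity)

variable {P : Params} {k N : ℕ} {s : ℝ}

/-- **The conjugated background assignment is the model's background field on the rescaled lattice**: for
`Ã = A^{(k),ε}` (3.29) with vector mass `μ₀²`, `σ⁻¹·A^{(k),ε}[σA′] = A^{(k),sε}_{μ₀²s⁻²}[A′]`, i.e.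
`extRescale hs (bgVec μ₀² a k) = bgVec^{sε} (μ₀²s⁻²) a k` (`μ₀² > 0`, `a ≥ 0`). PROVED
(`HiggsBackgroundRescale.bgVec_rescale`). [cite: Balaban1982Higgs1, (3.29) p.617] -/
theorem extRescale_bgVec (hs : 0 < s) {mu0sq a : ℝ} (hmu : 0 < mu0sq) (ha : 0 ≤ a) (k : ℕ) :
    extRescale hs (fun A : VecField P k => bgVec mu0sq a k A)
      = fun A' : VecField (P.scaleBy s hs) k => bgVec (P := P.scaleBy s hs) (mu0sq * s⁻¹ ^ 2) a k A' := by
  have hσ : s ^ (((P.d : ℝ) - 2) / 2) ≠ 0 := (Real.rpow_pos_of_pos hs _).ne'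
  funext A' b
  simp only [extRescale]
  rw [bgVec_rescale hs hmu ha k A']
  simp only [rescaleVec]
  rw [← mul_assoc, inv_mul_cancel₀ hσ, one_mul]

/-- The compatibility hypothesis `hext` of `B1Eq338Rescaling.doubleRTk_rescale` for the model's background fields:
`σ·A^{(k),sε}_{μ₀²s⁻²}[A′] = A^{(k),ε}_{μ₀²}[σA′]`. [cite: Balaban1982Higgs1, (3.29) p.617] -/
theorem hext_bgVec (hs : 0 < s) {mu0sq a : ℝ} (hmu : 0 < mu0sq) (ha : 0 ≤ a) (k : ℕ)
    (A' : VecField (P.scaleBy s hs) k) :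
    rescaleVec hs (bgVec (P := P.scaleBy s hs) (mu0sq * s⁻¹ ^ 2) a k A') = bgVec mu0sq a k (rescaleVec hs A') :=
  (bgVec_rescale hs hmu ha k A').symm

/-- The (3.26)/(3.37) density of the model in the product form `χ·e^{−S}` used by `B1Eq338Rescaling`. [cite: Balaban1982Higgs1, (3.37) p.618] -/
theorem cutoffDensity_eq (C : ChargeData N) (ℓ p mu0sq msq a : ℝ) (k : ℕ) (S : VecField P k → ScalarField P k N → ℝ) :
    cutoffDensity C ℓ p mu0sq msq a k S
      = fun A φ => (chiKA ℓ p mu0sq a k A * chiKφ C ℓ p mu0sq msq a k A φ) * Real.exp (-S A φ) := rfl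

/-- **(3.38) for the (Higgs)₂,₃ model with every model object identified** (`B1Eq338Rescaling.doubleRTk_rescale` ∘
`extRescale_bgVec` ∘ `B1Eq38Rescale.chiKA/chiKφ_rescale`): for `s > 0`, scale `ℓ > 0`, `μ₀², m² > 0`, `a ≥ 0`,
`T^{L^kε}_{a,L}[T^{L^kε}_{a,L,A^{(k),ε}}[χ^{ℓ}_k(A)χ^{ℓ}_k(A,φ)e^{−S}]](σB′, σψ′)
 = rescaleConstK · ∫dA′∫dφ′ χ^{sℓ}_k(A′)χ^{sℓ}_k(A′, φ′)·exp(stepExponent^{sε}_{e_s}(A^{(k),sε}_{μ₀²s⁻²}; S(σ·,σ·))(B′, ψ′; A′, φ′))`,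
the restrictions on the right being (3.27)–(3.28) OF THE RESCALED LATTICE (masses `μ₀²s⁻²`, `m²s⁻²`, charge `e_s`;
at `s = (L^kε)⁻¹`, `ℓ = L^kε` the unit-lattice `χ_k` of (3.38)). PROVED. [cite: Balaban1982Higgs1, (3.38) p.619] -/
theorem doubleRTk_rescale_model (hs : 0 < s) (C : ChargeData N) {mu0sq msq a : ℝ} (hmu : 0 < mu0sq)
    (hmsq : 0 < msq) (ha : 0 ≤ a) (k : ℕ) {ℓ : ℝ} (hℓ : 0 < ℓ) (p : ℝ) (S : VecField P k → ScalarField P k N → ℝ)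
    (B' : VecField (P.scaleBy s hs) (k + 1)) (ψ' : ScalarField (P.scaleBy s hs) (k + 1) N) :
    doubleRTk C a (fun A : VecField P k => bgVec mu0sq a k A) (cutoffDensity C ℓ p mu0sq msq a k S)
        (rescaleVec hs B') (rescaleScalar hs ψ')
      = rescaleConstK P k N a s
          * ∫ A' : VecField (P.scaleBy s hs) k, ∫ φ' : ScalarField (P.scaleBy s hs) k N,
              (chiKA (P := P.scaleBy s hs) (s * ℓ) p (mu0sq * s⁻¹ ^ 2) a k A'
                  * chiKφ (P := P.scaleBy s hs) (C.scaleBy P.d s) (s * ℓ) p (mu0sq * s⁻¹ ^ 2) (msq * s⁻¹ ^ 2)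
                      a k A' φ')
                * Real.exp (stepExponent (P := P.scaleBy s hs) (C.scaleBy P.d s) a
                    (fun A'' : VecField (P.scaleBy s hs) k => bgVec (P := P.scaleBy s hs) (mu0sq * s⁻¹ ^ 2) a k A'')
                    (fun A'' φ'' => S (rescaleVec hs A'') (rescaleScalar hs φ'')) B' ψ' A' φ') := by
  rw [cutoffDensity_eq,
    B1Eq338Rescaling.doubleRTk_rescale hs C a (ext := fun A : VecField P k => bgVec mu0sq a k A)
      (ext' := fun A'' : VecField (P.scaleBy s hs) k => bgVec (P := P.scaleBy s hs) (mu0sq * s⁻¹ ^ 2) a k A'')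
      (hext_bgVec hs hmu ha k) _ S B' ψ']
  simp only [chiKA_rescale hs hℓ p hmu ha k, chiKφ_rescale hs hℓ C p hmu hmsq ha k]

/-- The same with p14's conjugated assignment on the right rewritten AFTER the fact (`extRescale_bgVec`), for users
holding `B1Eq338Rescaling.doubleRTk_rescale … (rescaleVec_extRescale …)`. [cite: Balaban1982Higgs1, (3.38) p.619] -/
theorem stepExponent_extRescale_bgVec (hs : 0 < s) (C₁ : ChargeData N) {mu0sq a : ℝ} (hmu : 0 < mu0sq)
    (ha : 0 ≤ a) (k : ℕ) (S₁ : VecField (P.scaleBy s hs) k → ScalarField (P.scaleBy s hs) k N → ℝ) :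
    stepExponent (P := P.scaleBy s hs) C₁ a (extRescale hs (fun A : VecField P k => bgVec mu0sq a k A)) S₁
      = stepExponent (P := P.scaleBy s hs) C₁ a
          (fun A'' : VecField (P.scaleBy s hs) k => bgVec (P := P.scaleBy s hs) (mu0sq * s⁻¹ ^ 2) a k A'') S₁ := by
  rw [extRescale_bgVec hs hmu ha k]

end Literature.MathematicalPhysics.QuantumFieldTheory.Balaban1983to89.B1Eq338Bridge
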